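import Summits.QuantumFields.BalabanUV.T4Continuum.Spine.NE2BalabanRoot
import Summits.QuantumFields.BalabanUV.T4Continuum.Support.RegularBackgroundTowerSharp

/-!
# T⁴ programme, spine node NE2 (U1a) — THE TIER-B ASSEMBLY WITH THE SHARP RELATIVE BOUND: `κ_B` FREE OF NODE NE3's CONSTANT
# (row B5 × row B7 interface; the `t = 1` threshold is a condition on the regularity class and the B3/B4 slots ALONE)

NE2 formalisation swarm, leaf prover 03 (row B5), on top of leaf-08's LANDED `Spine/NE2BalabanLayer` / `Spine/NE2BalabanRoot` (row B7
part 2: `tierBPert`, `perturbationLaws_tierB`, `tierB_root`, `tierB_rate_at_one`; `balabanPert`, `perturbationLaws_balaban`,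
`balaban_rate_of_small`, `Kstar`) and this seat's LANDED `Support/RegularBackgroundTowerSharp` (row B5:
`perturbationLaws_covariantLaplacian_of_regular_sharp`, whose relative bound `κ = kappaCol o d a α β (d(α² + 2β))` depends on the
regularity class `(α, β)` ONLY — NE3's rate constant `C` enters the consistency constant `C₂` alone).  `NE2BalabanLayer.kappaB` carries
`max β βNE3(C)` (the merged Lipschitz/consistency slot of `LipschitzBackgroundM`), so its `t = 1` threshold `κ_B < 1` asks NE3's RATE
CONSTANT to be small (`NE2BalabanRoot.kappaB_le_of_small`'s binder `hCη : C ≤ η`; XREAD-p208485 INFO-1).  This file removes that: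
 * **`kappaBs o d a α β κ₃ κ₄ = kappaCol o d a α β (d(α² + 2β)) + κ₃ + κ₄`** (no `C`), **`C2Bs`** (where `C` lives);
 * **`perturbationLaws_tierB_sharp`** — same binders as `perturbationLaws_tierB` (`hreg`, `hNE3`, `hP₃`, `hP₄` displayed), conclusion with
   `(kappaBs, C2Bs)`; **`tierB_root_sharp`** (named limit, rate, NE2-LIP, holomorphy on `‖t‖κ < 1`), **`tierB_rate_at_one_sharp`**
   (`t = 1` under `kappaBs < 1`);
 * the threshold EXPLICIT and free of `C`: **`KstarS o d a = (card o)²·d·Cst·7 + 2`**, **`kappaBs_le_of_small`** (`α, β, κ₃, κ₄ ≤ η ≤ 1 ⟹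
   κ ≤ η·K⋆ₛ`), **`tierB_rate_of_small_sharp`** (`η·K⋆ₛ < 1 ⟹` the `t = 1` rate) — NE3's constant `C ≥ 0` is UNRESTRICTED;
 * the same for Bałaban's own covariant-averaging summand in the B3 slot (`NE2BalabanRoot.balabanPert`): **`perturbationLaws_balaban_sharp`**,
   **`balaban_rate_at_one_sharp`**, `KstarR o d a = 7·(card o)²·d·Cst + 3a·Cst + 1` (`KstarR_le_Kstar`), `kappaBs_balaban_le_of_small`
   (`α, β, ε, κ₄ ≤ η ≤ 1 ⟹ κ ≤ η·K⋆ᵣ`) and **`balaban_rate_of_small_sharp`** = leaf-08's `balaban_rate_of_small` WITHOUT the binder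
   `hCη : C ≤ η`.
`kappaBs ≤ kappaB` pointwise (`kappaBs_le_kappaB`) and `KstarR ≤ Kstar`: nothing of leaf-08's files is weakened or restated.

HONEST FRAMING (T4-DAG p. 1).  Pure re-assembly BY NAME; MODEL LEVEL (colour transporters DATA, GLOBAL small field, no B0 — c5); ROOT B
stays CONDITIONAL on node NE3's `LocalRate` (displayed, c2/c7), on the regularity class (c3) and on the slot laws `hP₃`/`hP₄` (rows B3/B4,
displayed, c4); carver's scope ruling c1 stands; NOT [B9] (3.23)–(3.26) as printed; **NE2 NOT PROVED**; NOT infinite volume, NOT a mass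
gap, NOT Clay, NOT summit progress; spine 0/9 unchanged.  HONEST DEPENDENCY: continuum YM on T⁴ ⇐ BetaPertH ∧ nine spine estimates (0/9
proved); BetaPertH ⇐ (D1) ∧ (D4) ∧ CAP+tail; G-an2-4 gates asym, D1 and NE2/3/4.  ABSOLUTE RULE kept; no `sorry`.
-/

noncomputable section

open scoped BigOperators ComplexConjugate Matrix Matrix.Norms.L2Operator Kronecker
open Filter Topology

namespace Summit.QuantumFields.BalabanUV.T4Continuum.NE2BalabanLayerSharp

open Literature.MathematicalPhysics.QuantumFieldTheory.Balaban1983to89.B5Prop11Plancherel (Cst Cst_nonneg)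
open Literature.MathematicalPhysics.QuantumFieldTheory.Balaban1983to89.T4EtaRateMin (LocalRate)
open Summit.QuantumFields.BalabanUV.T4Continuum
open Summit.QuantumFields.BalabanUV.T4Continuum.CovariantAveragingTower (TowerLimitRate)
open Summit.QuantumFields.BalabanUV.T4Continuum.BalabanAveragedTowerUnit (idx Qlev)
open Summit.QuantumFields.BalabanUV.T4Continuum.BackgroundResolventTower
open Summit.QuantumFields.BalabanUV.T4Continuum.KingPairingPlantedLaw
open Summit.QuantumFields.BalabanUV.T4Continuum.NE2PerturbedLayer
open Summit.QuantumFields.BalabanUV.T4Continuum.ColourCovariantLaplacian (covPertC kappaCol)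
open Summit.QuantumFields.BalabanUV.T4Continuum.NE2FromNE3 (bgReadings)
open Summit.QuantumFields.BalabanUV.T4Continuum.RegularBackgroundTower
open Summit.QuantumFields.BalabanUV.T4Continuum.RegularBackgroundTowerSharp
open Summit.QuantumFields.BalabanUV.T4Continuum.NE2ColourPerturbedLayer
open Summit.QuantumFields.BalabanUV.T4Continuum.NE2BalabanLayer
open Summit.QuantumFields.BalabanUV.T4Continuum.GramPerturbationLaw (AveragingLaws C2gram)
open Summit.QuantumFields.BalabanUV.T4Continuum.CovariantBlockAveraging (Ecov)
open Summit.QuantumFields.BalabanUV.T4Continuum.CovariantAveragingSummand (kappaQ kappaQ_ofReal)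
open Summit.QuantumFields.BalabanUV.T4Continuum.CovariantAveragingBalaban
open Summit.QuantumFields.BalabanUV.T4Continuum.NE2BalabanRoot (balabanPert Kstar)

variable {d : ℕ} (L : ℕ) [NeZero L] (M : Fin d → ℕ) [hM : ∀ μ, NeZero (M μ)] (a : ℝ) (ha : 0 < a)
variable {o : Type*} [Fintype o] [DecidableEq o]

/-- **THE SHARP TIER-B RELATIVE BOUND** `κ = κ_col(α, β, d(α² + 2β)) + κ₃ + κ₄` — free of NE3's constant. [folklore] -/
def kappaBs (o : Type*) [Fintype o] (d : ℕ) (a α β κ₃ κ₄ : ℝ) : ℝ :=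
  kappaCol o d a α β (d * (α ^ 2 + 2 * β)) + κ₃ + κ₄

/-- the matching consistency constant `C₂ = C2colSplit(α, β, βNE3, d(2α(βNE3 + β) + 2βNE3)) + C₃ + C₄` (NE3's `C` lives here). [folklore] -/
def C2Bs (o : Type*) [Fintype o] (d L : ℕ) (a α β C C₃ C₄ : ℝ) : ℝ :=
  C2colSplit o d L a α β (betaNE3 o C) (d * (2 * α * (betaNE3 o C + β) + 2 * betaNE3 o C)) + C₃ + C₄

omit [DecidableEq o] in
/-- `κ_sharp ≤ κ_B` (the merged slot `max β βNE3` only enlarges `κ_col`, which is monotone in its Lipschitz argument). [folklore] -/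
theorem kappaBs_le_kappaB (α β C κ₃ κ₄ : ℝ) : kappaBs o d a α β κ₃ κ₄ ≤ kappaB o d a α β C κ₃ κ₄ := by
  unfold kappaBs kappaB ColourCovariantLaplacian.kappaCol
  have hCst := Cst_nonneg d a
  have hm : (0 : ℝ) ≤ (Fintype.card o : ℝ) ^ 2 := sq_nonneg _
  have hd : (0 : ℝ) ≤ d := Nat.cast_nonneg _
  have h1 : α + β ≤ α + max β (betaNE3 o C) := by linarith [le_max_left β (betaNE3 o C)]
  have h2 : d * (α + β) * Cst d a ≤ d * (α + max β (betaNE3 o C)) * Cst d a :=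
    mul_le_mul_of_nonneg_right (mul_le_mul_of_nonneg_left h1 hd) hCst
  nlinarith [mul_le_mul_of_nonneg_left (show 2 * (d * (α + β) * Cst d a) ≤ 2 * (d * (α + max β (betaNE3 o C)) * Cst d a) by linarith) hm]

/-- **`PerturbationLaws` FOR THE ASSEMBLED TIER-B PERTURBATION, SHARP `κ`** (`d ≥ 1`): binders `hreg` (row B5), `hNE3` (node NE3 BY NAME
on `{w, Dw}`), `hP₃`, `hP₄` (rows B3/B4) displayed; conclusion with `(kappaBs, C2Bs)`. [folklore] -/
theorem perturbationLaws_tierB_sharp (hd : 1 ≤ d) {R : (k : ℕ) → Fin d → (idx L M k → Matrix o o ℂ)} {α β : ℝ}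
    (hreg : RegularTransporters L M R α β) {C : ℝ} (hC : 0 ≤ C) (hNE3 : LocalRate (bgReadings L M (regClass L M R)) C ((L : ℝ)⁻¹))
    {P₃ P₄ : (k : ℕ) → Matrix (idx L M k × o) (idx L M k × o) ℂ} {κ₃ C₃ κ₄ C₄ : ℝ}
    (hP₃ : PerturbationLaws (fun k => calDalev L M a ha k ⊗ₖ (1 : Matrix o o ℂ)) P₃ (fun k => JpcT L M k ⊗ₖ (1 : Matrix o o ℂ)) κ₃
      (fun k => C₃ * ((L : ℝ)⁻¹) ^ k))
    (hP₄ : PerturbationLaws (fun k => calDalev L M a ha k ⊗ₖ (1 : Matrix o o ℂ)) P₄ (fun k => JpcT L M k ⊗ₖ (1 : Matrix o o ℂ)) κ₄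
      (fun k => C₄ * ((L : ℝ)⁻¹) ^ k)) :
    PerturbationLaws (fun k => calDalev L M a ha k ⊗ₖ (1 : Matrix o o ℂ)) (tierBPert L M R P₃ P₄)
      (fun k => JpcT L M k ⊗ₖ (1 : Matrix o o ℂ)) (kappaBs o d a α β κ₃ κ₄) (fun k => C2Bs o d L a α β C C₃ C₄ * ((L : ℝ)⁻¹) ^ k) :=
  perturbationLaws_add₃ (perturbationLaws_covariantLaplacian_of_regular_sharp L M a ha hd hreg hC hNE3) hP₃ hP₄

/-- **ROOT B, SHARP `κ`, EVERY BINDER DISPLAYED** (`L ≥ 2`, `d ≥ 1`): for every `‖t‖κ < 1` the named limit with rate `L^{−k}`, NE2-LIP and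
holomorphy, CONDITIONAL on `hNE3`, `hreg`, `hP₃`, `hP₄`.  NE2 is NOT proved by this. [folklore] -/
theorem tierB_root_sharp (hL : 2 ≤ L) (hd : 1 ≤ d) {R : (k : ℕ) → Fin d → (idx L M k → Matrix o o ℂ)} {α β : ℝ}
    (hreg : RegularTransporters L M R α β) {C : ℝ} (hC : 0 ≤ C) (hNE3 : LocalRate (bgReadings L M (regClass L M R)) C ((L : ℝ)⁻¹))
    {P₃ P₄ : (k : ℕ) → Matrix (idx L M k × o) (idx L M k × o) ℂ} {κ₃ C₃ κ₄ C₄ : ℝ}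
    (hP₃ : PerturbationLaws (fun k => calDalev L M a ha k ⊗ₖ (1 : Matrix o o ℂ)) P₃ (fun k => JpcT L M k ⊗ₖ (1 : Matrix o o ℂ)) κ₃
      (fun k => C₃ * ((L : ℝ)⁻¹) ^ k))
    (hP₄ : PerturbationLaws (fun k => calDalev L M a ha k ⊗ₖ (1 : Matrix o o ℂ)) P₄ (fun k => JpcT L M k ⊗ₖ (1 : Matrix o o ℂ)) κ₄
      (fun k => C₄ * ((L : ℝ)⁻¹) ^ k)) {t : ℂ} (ht : ‖t‖ * kappaBs o d a α β κ₃ κ₄ < 1) :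
    Tendsto (pertCovC L M a ha (tierBPert L M R P₃ P₄) t) atTop (𝓝 (pertLimC L M a ha (tierBPert L M R P₃ P₄) t)) ∧
      Tendsto (pertCovC L M a ha (tierBPert L M R P₃ P₄) 0) atTop (𝓝 (pertLimC L M a ha (tierBPert L M R P₃ P₄) 0)) ∧
      (∀ k, ‖pertCovC L M a ha (tierBPert L M R P₃ P₄) t k - pertLimC L M a ha (tierBPert L M R P₃ P₄) t‖
          ≤ Cpert (kappaBs o d a α β κ₃ κ₄) (2 * d * Cst d a) (CJ d a) (C2Bs o d L a α β C C₃ C₄) 0 t * ((L : ℝ)⁻¹) ^ k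
              / (1 - (L : ℝ)⁻¹)) ∧
      ‖pertLimC L M a ha (tierBPert L M R P₃ P₄) t - pertLimC L M a ha (tierBPert L M R P₃ P₄) 0‖
          ≤ ‖t‖ * kappaBs o d a α β κ₃ κ₄ * Cst d a * (1 - ‖t‖ * kappaBs o d a α β κ₃ κ₄)⁻¹ ∧
      DifferentiableOn ℂ (pertLimC L M a ha (tierBPert L M R P₃ P₄)) {t : ℂ | ‖t‖ * kappaBs o d a α β κ₃ κ₄ < 1} :=
  ne2Plus_resolvent_route_kron L M a ha hL (perturbationLaws_tierB_sharp L M a ha hd hreg hC hNE3 hP₃ hP₄) ht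

/-- **THE PHYSICAL VALUE `t = 1`, SHARP THRESHOLD** `kappaBs < 1` — a condition on `(card o, d, a, α, β, κ₃, κ₄)`, free of NE3's constant.
[folklore] -/
theorem tierB_rate_at_one_sharp (hL : 2 ≤ L) (hd : 1 ≤ d) {R : (k : ℕ) → Fin d → (idx L M k → Matrix o o ℂ)} {α β : ℝ}
    (hreg : RegularTransporters L M R α β) {C : ℝ} (hC : 0 ≤ C) (hNE3 : LocalRate (bgReadings L M (regClass L M R)) C ((L : ℝ)⁻¹))
    {P₃ P₄ : (k : ℕ) → Matrix (idx L M k × o) (idx L M k × o) ℂ} {κ₃ C₃ κ₄ C₄ : ℝ}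
    (hP₃ : PerturbationLaws (fun k => calDalev L M a ha k ⊗ₖ (1 : Matrix o o ℂ)) P₃ (fun k => JpcT L M k ⊗ₖ (1 : Matrix o o ℂ)) κ₃
      (fun k => C₃ * ((L : ℝ)⁻¹) ^ k))
    (hP₄ : PerturbationLaws (fun k => calDalev L M a ha k ⊗ₖ (1 : Matrix o o ℂ)) P₄ (fun k => JpcT L M k ⊗ₖ (1 : Matrix o o ℂ)) κ₄
      (fun k => C₄ * ((L : ℝ)⁻¹) ^ k)) (hsmall : kappaBs o d a α β κ₃ κ₄ < 1) :
    TowerLimitRate (fun k => Qlev L M k ⊗ₖ (1 : Matrix o o ℂ)) ((L : ℝ) ^ d)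
      (fun k => (calDalev L M a ha k ⊗ₖ (1 : Matrix o o ℂ) + tierBPert L M R P₃ P₄ k)⁻¹)
      (Cpert (kappaBs o d a α β κ₃ κ₄) (2 * d * Cst d a) (CJ d a) (C2Bs o d L a α β C C₃ C₄) 0 1) ((L : ℝ)⁻¹) := by
  have h := towerLimitRate_perturbed_king_kron L M a ha hL (perturbationLaws_tierB_sharp L M a ha hd hreg hC hNE3 hP₃ hP₄) (t := 1)
    (by rwa [norm_one, one_mul])
  simpa only [one_smul] using h

/-! ## The threshold EXPLICIT in `(card o, d, a)` and free of NE3's constant -/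

/-- the explicit sharp threshold constant `K⋆ₛ = 7·(card o)²·d·Cst + 2` (OURS, crude). [folklore] -/
def KstarS (o : Type*) [Fintype o] (d : ℕ) (a : ℝ) : ℝ :=
  7 * ((Fintype.card o : ℝ) ^ 2 * (d * Cst d a)) + 2

omit [DecidableEq o] in
/-- **THE SHARP SMALL-FIELD THRESHOLD**: if the regularity class and the two slot bounds are small, `α, β, κ₃, κ₄ ≤ η ≤ 1`, then
`κ ≤ η·K⋆ₛ(card o, d, a)` — whatever NE3's constant `C` is. [folklore] -/
theorem kappaBs_le_of_small {α β κ₃ κ₄ η : ℝ} (hα : 0 ≤ α) (hαη : α ≤ η) (hβη : β ≤ η) (hκ₃ : κ₃ ≤ η) (hκ₄ : κ₄ ≤ η)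
    (hη1 : η ≤ 1) : kappaBs o d a α β κ₃ κ₄ ≤ η * KstarS o d a := by
  have hCst := Cst_nonneg d a
  have hm : (0 : ℝ) ≤ (Fintype.card o : ℝ) ^ 2 := sq_nonneg _
  have hd : (0 : ℝ) ≤ d := Nat.cast_nonneg _
  have hη : 0 ≤ η := hα.trans hαη
  have hsq : α ^ 2 ≤ η := by nlinarith
  have h1 : d * (α + β) * Cst d a ≤ d * (2 * η) * Cst d a :=
    mul_le_mul_of_nonneg_right (mul_le_mul_of_nonneg_left (by linarith) hd) hCst
  have h2 : d * (α ^ 2 + 2 * β) * Cst d a ≤ d * (3 * η) * Cst d a :=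
    mul_le_mul_of_nonneg_right (mul_le_mul_of_nonneg_left (by linarith) hd) hCst
  have h12 : (Fintype.card o : ℝ) ^ 2 * (2 * (d * (α + β) * Cst d a) + d * (α ^ 2 + 2 * β) * Cst d a)
      ≤ (Fintype.card o : ℝ) ^ 2 * (2 * (d * (2 * η) * Cst d a) + d * (3 * η) * Cst d a) :=
    mul_le_mul_of_nonneg_left (by linarith) hm
  unfold kappaBs ColourCovariantLaplacian.kappaCol KstarS
  have e : (Fintype.card o : ℝ) ^ 2 * (2 * (d * (2 * η) * Cst d a) + d * (3 * η) * Cst d a) + η + η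
      = η * (7 * ((Fintype.card o : ℝ) ^ 2 * (d * Cst d a)) + 2) := by ring
  linarith [h12, hκ₃, hκ₄, e.le]

/-- **ROOT B AT `t = 1` WITH THE SHARP EXPLICIT THRESHOLD** (`L ≥ 2`, `d ≥ 1`): `α, β, κ₃, κ₄ ≤ η ≤ 1` and `η·K⋆ₛ < 1` ⟹ the `t = 1`
tower limit with rate `L^{−k}` — CONDITIONAL on `hNE3` (ANY constant `C ≥ 0`), `hreg`, `hP₃`, `hP₄`, displayed.  NE2 is NOT proved by
this. [folklore] -/
theorem tierB_rate_of_small_sharp (hL : 2 ≤ L) (hd : 1 ≤ d) {R : (k : ℕ) → Fin d → (idx L M k → Matrix o o ℂ)} {α β : ℝ}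
    (hreg : RegularTransporters L M R α β) {C : ℝ} (hC : 0 ≤ C) (hNE3 : LocalRate (bgReadings L M (regClass L M R)) C ((L : ℝ)⁻¹))
    {P₃ P₄ : (k : ℕ) → Matrix (idx L M k × o) (idx L M k × o) ℂ} {κ₃ C₃ κ₄ C₄ : ℝ}
    (hP₃ : PerturbationLaws (fun k => calDalev L M a ha k ⊗ₖ (1 : Matrix o o ℂ)) P₃ (fun k => JpcT L M k ⊗ₖ (1 : Matrix o o ℂ)) κ₃
      (fun k => C₃ * ((L : ℝ)⁻¹) ^ k))
    (hP₄ : PerturbationLaws (fun k => calDalev L M a ha k ⊗ₖ (1 : Matrix o o ℂ)) P₄ (fun k => JpcT L M k ⊗ₖ (1 : Matrix o o ℂ)) κ₄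
      (fun k => C₄ * ((L : ℝ)⁻¹) ^ k)) {η : ℝ} (hαη : α ≤ η) (hβη : β ≤ η) (hκ₃ : κ₃ ≤ η) (hκ₄ : κ₄ ≤ η) (hη1 : η ≤ 1)
    (hηK : η * KstarS o d a < 1) :
    TowerLimitRate (fun k => Qlev L M k ⊗ₖ (1 : Matrix o o ℂ)) ((L : ℝ) ^ d)
      (fun k => (calDalev L M a ha k ⊗ₖ (1 : Matrix o o ℂ) + tierBPert L M R P₃ P₄ k)⁻¹)
      (Cpert (kappaBs o d a α β κ₃ κ₄) (2 * d * Cst d a) (CJ d a) (C2Bs o d L a α β C C₃ C₄) 0 1) ((L : ℝ)⁻¹) :=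
  tierB_rate_at_one_sharp L M a ha hL hd hreg hC hNE3 hP₃ hP₄
    ((kappaBs_le_of_small a hreg.nonneg.1 hαη hβη hκ₃ hκ₄ hη1).trans_lt hηK)

/-! ## Bałaban's own covariant-averaging summand in the B3 slot (`NE2BalabanRoot.balabanPert`), sharp threshold -/

/-- **`perturbationLaws_balaban`, SHARP `κ`**: leaf-08's binders verbatim (`hreg`, `hNE3`, `hE`, `hP₄`), conclusion with
`κ = kappaBs o d a α β (kappaQ d a a ε) κ₄` — free of NE3's constant `C`. [folklore] -/
theorem perturbationLaws_balaban_sharp (hd : 1 ≤ d) {R : (k : ℕ) → Fin d → (idx L M k → Matrix o o ℂ)} {α β : ℝ}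
    (hreg : RegularTransporters L M R α β) {C : ℝ} (hC : 0 ≤ C) (hNE3 : LocalRate (bgReadings L M (regClass L M R)) C ((L : ℝ)⁻¹))
    {ε Cδ : ℝ} (hε : 0 ≤ ε)
    (hE : AveragingLaws (fun k => calDalev L M a ha k ⊗ₖ (1 : Matrix o o ℂ)) (Ecov L M R)
      (fun k => JpcT L M k ⊗ₖ (1 : Matrix o o ℂ)) ε (fun k => Cδ * ((L : ℝ)⁻¹) ^ k))
    {P₄ : (k : ℕ) → Matrix (idx L M k × o) (idx L M k × o) ℂ} {κ₄ C₄ : ℝ}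
    (hP₄ : PerturbationLaws (fun k => calDalev L M a ha k ⊗ₖ (1 : Matrix o o ℂ)) P₄ (fun k => JpcT L M k ⊗ₖ (1 : Matrix o o ℂ)) κ₄
      (fun k => C₄ * ((L : ℝ)⁻¹) ^ k)) :
    PerturbationLaws (fun k => calDalev L M a ha k ⊗ₖ (1 : Matrix o o ℂ)) (balabanPert L M a R P₄)
      (fun k => JpcT L M k ⊗ₖ (1 : Matrix o o ℂ)) (kappaBs o d a α β (kappaQ d a (a : ℂ) ε) κ₄)
      (fun k => C2Bs o d L a α β C (a * C2gram (Cst d a) 1 ε (2 * d * Cst d a) (CJ d a) (Cst d a) Cδ) C₄ * ((L : ℝ)⁻¹) ^ k) :=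
  perturbationLaws_tierB_sharp L M a ha hd hreg hC hNE3
    (perturbationLaws_covariantAveraging_balaban L M a ha o hε (LineAveragingPairing.averagingLaws_Bfree L M a ha) hE) hP₄

/-- **THE PHYSICAL VALUE `t = 1` FOR `balabanPert`, SHARP THRESHOLD** `kappaBs … (a·ε(2+ε)Cst) κ₄ < 1` (no `C`). [folklore] -/
theorem balaban_rate_at_one_sharp (hL : 2 ≤ L) (hd : 1 ≤ d) {R : (k : ℕ) → Fin d → (idx L M k → Matrix o o ℂ)} {α β : ℝ}
    (hreg : RegularTransporters L M R α β) {C : ℝ} (hC : 0 ≤ C) (hNE3 : LocalRate (bgReadings L M (regClass L M R)) C ((L : ℝ)⁻¹))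
    {ε Cδ : ℝ} (hε : 0 ≤ ε)
    (hE : AveragingLaws (fun k => calDalev L M a ha k ⊗ₖ (1 : Matrix o o ℂ)) (Ecov L M R)
      (fun k => JpcT L M k ⊗ₖ (1 : Matrix o o ℂ)) ε (fun k => Cδ * ((L : ℝ)⁻¹) ^ k))
    {P₄ : (k : ℕ) → Matrix (idx L M k × o) (idx L M k × o) ℂ} {κ₄ C₄ : ℝ}
    (hP₄ : PerturbationLaws (fun k => calDalev L M a ha k ⊗ₖ (1 : Matrix o o ℂ)) P₄ (fun k => JpcT L M k ⊗ₖ (1 : Matrix o o ℂ)) κ₄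
      (fun k => C₄ * ((L : ℝ)⁻¹) ^ k)) (hsmall : kappaBs o d a α β (a * (ε * (2 + ε) * Cst d a)) κ₄ < 1) :
    TowerLimitRate (fun k => Qlev L M k ⊗ₖ (1 : Matrix o o ℂ)) ((L : ℝ) ^ d)
      (fun k => (calDalev L M a ha k ⊗ₖ (1 : Matrix o o ℂ) + balabanPert L M a R P₄ k)⁻¹)
      (Cpert (kappaBs o d a α β (a * (ε * (2 + ε) * Cst d a)) κ₄) (2 * d * Cst d a) (CJ d a)
        (C2Bs o d L a α β C (a * C2gram (Cst d a) 1 ε (2 * d * Cst d a) (CJ d a) (Cst d a) Cδ) C₄) 0 1) ((L : ℝ)⁻¹) := by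
  have h := tierB_rate_at_one_sharp L M a ha hL hd hreg hC hNE3
    (perturbationLaws_covariantAveraging_balaban L M a ha o hε (LineAveragingPairing.averagingLaws_Bfree L M a ha) hE) hP₄
  rw [kappaQ_ofReal ha.le] at h
  exact h hsmall

/-- the explicit sharp threshold constant for `balabanPert`: `K⋆ᵣ = 7·(card o)²·d·Cst + 3a·Cst + 1` (OURS; compare leaf-08's
`Kstar = (card o)²·d·Cst·(4·card o + 7) + 3a·Cst + 1`, whose `4·card o` part is NE3's constant). [folklore] -/
def KstarR (o : Type*) [Fintype o] (d : ℕ) (a : ℝ) : ℝ :=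
  7 * ((Fintype.card o : ℝ) ^ 2 * (d * Cst d a)) + 3 * a * Cst d a + 1

omit [DecidableEq o] in
/-- **THE SHARP SMALL-FIELD THRESHOLD FOR `balabanPert`**: `α, β, ε, κ₄ ≤ η ≤ 1` ⟹ `κ ≤ η·K⋆ᵣ` — NE3's constant does not enter. [folklore] -/
theorem kappaBs_balaban_le_of_small (ha0 : 0 ≤ a) {α β ε κ₄ η : ℝ} (hα : 0 ≤ α) (hε : 0 ≤ ε) (hαη : α ≤ η) (hβη : β ≤ η)
    (hεη : ε ≤ η) (hκη : κ₄ ≤ η) (hη1 : η ≤ 1) :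
    kappaBs o d a α β (a * (ε * (2 + ε) * Cst d a)) κ₄ ≤ η * KstarR o d a := by
  have hCst := Cst_nonneg d a
  have hm : (0 : ℝ) ≤ (Fintype.card o : ℝ) ^ 2 := sq_nonneg _
  have hd : (0 : ℝ) ≤ d := Nat.cast_nonneg _
  have hη : 0 ≤ η := hα.trans hαη
  have hsq : α ^ 2 ≤ η := by nlinarith
  have h1 : d * (α + β) * Cst d a ≤ d * (2 * η) * Cst d a :=
    mul_le_mul_of_nonneg_right (mul_le_mul_of_nonneg_left (by linarith) hd) hCst
  have h2 : d * (α ^ 2 + 2 * β) * Cst d a ≤ d * (3 * η) * Cst d a :=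
    mul_le_mul_of_nonneg_right (mul_le_mul_of_nonneg_left (by linarith) hd) hCst
  have h3 : a * (ε * (2 + ε) * Cst d a) ≤ a * (3 * η * Cst d a) := by
    have : ε * (2 + ε) ≤ 3 * η := by nlinarith
    exact mul_le_mul_of_nonneg_left (mul_le_mul_of_nonneg_right this hCst) ha0
  have h12 : (Fintype.card o : ℝ) ^ 2 * (2 * (d * (α + β) * Cst d a) + d * (α ^ 2 + 2 * β) * Cst d a)
      ≤ (Fintype.card o : ℝ) ^ 2 * (2 * (d * (2 * η) * Cst d a) + d * (3 * η) * Cst d a) :=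
    mul_le_mul_of_nonneg_left (by linarith) hm
  unfold kappaBs ColourCovariantLaplacian.kappaCol KstarR
  have e : (Fintype.card o : ℝ) ^ 2 * (2 * (d * (2 * η) * Cst d a) + d * (3 * η) * Cst d a) + a * (3 * η * Cst d a) + η
      = η * (7 * ((Fintype.card o : ℝ) ^ 2 * (d * Cst d a)) + 3 * a * Cst d a + 1) := by ring
  linarith [h12, h3, hκη, e.le]

omit [NeZero L] hM [DecidableEq o] in
/-- `K⋆ᵣ ≤ K⋆` (the sharp threshold is never more demanding than leaf-08's). [folklore] -/
theorem KstarR_le_Kstar : KstarR o d a ≤ Kstar o d a := by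
  unfold KstarR NE2BalabanRoot.Kstar
  have hCst := Cst_nonneg d a
  have hm : (0 : ℝ) ≤ Fintype.card o := Nat.cast_nonneg _
  have hd : (0 : ℝ) ≤ d := Nat.cast_nonneg _
  nlinarith [mul_nonneg (mul_nonneg (sq_nonneg (Fintype.card o : ℝ)) (mul_nonneg hd hCst)) hm]

/-- **ROOT B AT `t = 1` FOR BAŁABAN's TYPED TIER-B OPERATOR WITH THE SHARP EXPLICIT THRESHOLD** (`L ≥ 2`, `d ≥ 1`): the regularity
class `α, β ≤ η`, the transport size `ε ≤ η`, the gauge slot's `κ₄ ≤ η`, `η ≤ 1` and `η·K⋆ᵣ(card o, d, a) < 1` ⟹ the lifted King-averaged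
unit-lattice covariances of `(Δ_a^{(k)} ⊗ 1 + balabanPert R P₄ k)⁻¹` CONVERGE with rate `L^{−k}` — CONDITIONAL on `hNE3` (node NE3, ANY
constant `C ≥ 0`), `hreg`, `hE`, `hP₄`, displayed.  NE2 is NOT proved by this. [folklore] -/
theorem balaban_rate_of_small_sharp (hL : 2 ≤ L) (hd : 1 ≤ d) {R : (k : ℕ) → Fin d → (idx L M k → Matrix o o ℂ)} {α β : ℝ}
    (hreg : RegularTransporters L M R α β) {C : ℝ} (hC : 0 ≤ C) (hNE3 : LocalRate (bgReadings L M (regClass L M R)) C ((L : ℝ)⁻¹))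
    {ε Cδ : ℝ} (hε : 0 ≤ ε)
    (hE : AveragingLaws (fun k => calDalev L M a ha k ⊗ₖ (1 : Matrix o o ℂ)) (Ecov L M R)
      (fun k => JpcT L M k ⊗ₖ (1 : Matrix o o ℂ)) ε (fun k => Cδ * ((L : ℝ)⁻¹) ^ k))
    {P₄ : (k : ℕ) → Matrix (idx L M k × o) (idx L M k × o) ℂ} {κ₄ C₄ : ℝ}
    (hP₄ : PerturbationLaws (fun k => calDalev L M a ha k ⊗ₖ (1 : Matrix o o ℂ)) P₄ (fun k => JpcT L M k ⊗ₖ (1 : Matrix o o ℂ)) κ₄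
      (fun k => C₄ * ((L : ℝ)⁻¹) ^ k)) {η : ℝ} (hαη : α ≤ η) (hβη : β ≤ η) (hεη : ε ≤ η) (hκη : κ₄ ≤ η) (hη1 : η ≤ 1)
    (hηK : η * KstarR o d a < 1) :
    TowerLimitRate (fun k => Qlev L M k ⊗ₖ (1 : Matrix o o ℂ)) ((L : ℝ) ^ d)
      (fun k => (calDalev L M a ha k ⊗ₖ (1 : Matrix o o ℂ) + balabanPert L M a R P₄ k)⁻¹)
      (Cpert (kappaBs o d a α β (a * (ε * (2 + ε) * Cst d a)) κ₄) (2 * d * Cst d a) (CJ d a)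
        (C2Bs o d L a α β C (a * C2gram (Cst d a) 1 ε (2 * d * Cst d a) (CJ d a) (Cst d a) Cδ) C₄) 0 1) ((L : ℝ)⁻¹) :=
  balaban_rate_at_one_sharp L M a ha hL hd hreg hC hNE3 hε hE hP₄
    ((kappaBs_balaban_le_of_small a ha.le hreg.nonneg.1 hε hαη hβη hεη hκη hη1).trans_lt hηK)

end Summit.QuantumFields.BalabanUV.T4Continuum.NE2BalabanLayerSharp

end
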